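import Mathlib
import Summits.Ventures.PercRepro2.Defs
import Summits.Ventures.PercRepro2.Independence
import Summits.Ventures.PercRepro2.Harris
import Summits.Ventures.PercRepro2.Graph
import Summits.Ventures.PercRepro2.Events
import Summits.Ventures.PercRepro2.ZCDismantle6
import Summits.Ventures.PercRepro2.ZCK4
import Summits.Ventures.PercRepro2.ZCK4Embed

/-!
# (ZC) on graphs that dismantle to a `K₄` (blind cell PercRepro2, mine-a g27)

The dismantling theorem `zc_of_dismantling₆` needs (ZC) for the final weights and marks as its base; with
`zc_k4_embed` that base is available whenever the remaining positive-weight edges form a `K₄` on the three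
(distinct) final marks and one more vertex.  The examples: `K₄` plus a pendant non-mark, `K₄` plus a pendant
mark (the mark moves onto the `K₄`), and a seven-vertex cell that uses several record kinds before the base.
Record lists by the dismantler with the `K₄` base (own code, `k4base_emit.py`); every side condition by `decide`.
-/

namespace Summit.Ventures.PercRepro2

/-- **`K₄` plus a pendant non-mark**: vertices `0..4`, the `K₄` on `0, 1, 2, 3` and the leaf `4` at `3`, marks `(0, 1, 2)`: strip the leaf, then the `K₄` base. -/
theorem zc_k4_pendant {R : Type*} [CommRing R] [LinearOrder R] [IsStrictOrderedRing R]
    {p : Fin 7 → R} (hp : IsProbVec p) {𝓔 : Set (Set (Fin 5))} (h𝓔 : IsUpperSet 𝓔) :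
    let ends : Fin 7 → Sym2 (Fin 5) := ![s(0, 1), s(0, 2), s(0, 3), s(1, 2), s(1, 3), s(2, 3), s(3, 4)]
    let e := connEvent ends 0 1
    let L' := connEvent ends 0 2
    let U := clusterInEvent ends 0 𝓔
    let γ := connEvent ends 1 2
    0 ≤ prob p (eᶜ ∩ L'ᶜ ∩ γᶜ) * (prob p (U ∩ (e ∩ L')) - prob p U * prob p (e ∩ L'))
      - prob p (eᶜ ∩ L'ᶜ ∩ γ) * (prob p (U ∩ (e ∩ L'ᶜ)) - prob p U * prob p (e ∩ L'ᶜ)) := by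
  intro ends e L' U γ
  have hb : ∀ 𝓔' : Set (Set (Fin 5)), IsUpperSet 𝓔' →
      let e := connEvent ends 0 1
      let L' := connEvent ends 0 2
      let U := clusterInEvent ends 0 𝓔'
      let γ := connEvent ends 1 2
      0 ≤ prob (Function.update (Function.update p 6 0) 6 0) (eᶜ ∩ L'ᶜ ∩ γᶜ) * (prob (Function.update (Function.update p 6 0) 6 0) (U ∩ (e ∩ L')) - prob (Function.update (Function.update p 6 0) 6 0) U * prob (Function.update (Function.update p 6 0) 6 0) (e ∩ L'))
        - prob (Function.update (Function.update p 6 0) 6 0) (eᶜ ∩ L'ᶜ ∩ γ) * (prob (Function.update (Function.update p 6 0) 6 0) (U ∩ (e ∩ L'ᶜ)) - prob (Function.update (Function.update p 6 0) 6 0) U * prob (Function.update (Function.update p 6 0) 6 0) (e ∩ L'ᶜ)) := by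
    intro 𝓔' h𝓔'
    have := zc_k4_embed (ends := ends) (p := (Function.update (Function.update p 6 0) 6 0)) (((hp).update 6 le_rfl zero_le_one).update 6 le_rfl zero_le_one) (ι := ![0, 1, 2, 3]) (by decide)
      (φ := ![0, 1, 2, 3, 4, 5]) (by decide) (by decide) ?_ h𝓔'
    · simpa using this
    intro e he
    fin_cases e
    · exact absurd he (by decide)
    · exact absurd he (by decide)
    · exact absurd he (by decide)
    · exact absurd he (by decide)
    · exact absurd he (by decide)
    · exact absurd he (by decide)
    · simp [Function.update]
  have h := zc_of_dismantling₆ (ends := ends)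
    [((4 : Fin 7), (6 : Fin 7), (6 : Fin 7), (4 : Fin 5), (3 : Fin 5), (0 : Fin 5), (1 : Fin 5), (2 : Fin 5))]
    (by decide) (by decide) (by decide) p hp
    (by intro r hr e he; simp only [List.mem_singleton] at hr; subst hr; fin_cases e <;> simp [ends] at he ⊢)
    (0, 1, 2) 𝓔 h𝓔 (by intro r hr; simp at hr; rw [← hr])
    (by intro 𝓔' h𝓔'; simpa using hb 𝓔' h𝓔')
  simpa using h

/-- **A seven-vertex, eleven-edge cell ending in a `K₄` base** (the engine's `c7_00352`: the triangle `0, 1, 2` joined to the `K₄` on `3, 4, 5, 6` by the edges `1 – 6` and `2 – 5`), marks `(0, 1, 3)`: F at `0` (`w = 2`), E at `1` (`w = 6`), the leaf `2` at `5` — the root travels `0 → 2 → 5`, the `a₃`-mark `1 → 6` — then the `K₄` on `3, 4, 5, 6` with the marks `(5, 6, 3)`; a cell outside the dismantlable class `C1c` of MINE-A.md §73.2. -/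
theorem zc_seven_eleven_k4 {R : Type*} [CommRing R] [LinearOrder R] [IsStrictOrderedRing R]
    {p : Fin 11 → R} (hp : IsProbVec p) {𝓔 : Set (Set (Fin 7))} (h𝓔 : IsUpperSet 𝓔) :
    let ends : Fin 11 → Sym2 (Fin 7) := ![s(0, 1), s(0, 2), s(1, 2), s(1, 6), s(2, 5), s(3, 4), s(3, 5), s(3, 6), s(4, 5), s(4, 6), s(5, 6)]
    let e := connEvent ends 0 1
    let L' := connEvent ends 0 3
    let U := clusterInEvent ends 0 𝓔
    let γ := connEvent ends 1 3
    0 ≤ prob p (eᶜ ∩ L'ᶜ ∩ γᶜ) * (prob p (U ∩ (e ∩ L')) - prob p U * prob p (e ∩ L'))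
      - prob p (eᶜ ∩ L'ᶜ ∩ γ) * (prob p (U ∩ (e ∩ L'ᶜ)) - prob p U * prob p (e ∩ L'ᶜ)) := by
  intro ends e L' U γ
  have hb : ∀ 𝓔' : Set (Set (Fin 7)), IsUpperSet 𝓔' →
      let e := connEvent ends 5 6
      let L' := connEvent ends 5 3
      let U := clusterInEvent ends 5 𝓔'
      let γ := connEvent ends 6 3
      0 ≤ prob (Function.update (Function.update (Function.update (Function.update (Function.update (Function.update p 0 0) 1 0) 2 0) 3 0) 4 0) 4 0) (eᶜ ∩ L'ᶜ ∩ γᶜ) * (prob (Function.update (Function.update (Function.update (Function.update (Function.update (Function.update p 0 0) 1 0) 2 0) 3 0) 4 0) 4 0) (U ∩ (e ∩ L')) - prob (Function.update (Function.update (Function.update (Function.update (Function.update (Function.update p 0 0) 1 0) 2 0) 3 0) 4 0) 4 0) U * prob (Function.update (Function.update (Function.update (Function.update (Function.update (Function.update p 0 0) 1 0) 2 0) 3 0) 4 0) 4 0) (e ∩ L'))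
        - prob (Function.update (Function.update (Function.update (Function.update (Function.update (Function.update p 0 0) 1 0) 2 0) 3 0) 4 0) 4 0) (eᶜ ∩ L'ᶜ ∩ γ) * (prob (Function.update (Function.update (Function.update (Function.update (Function.update (Function.update p 0 0) 1 0) 2 0) 3 0) 4 0) 4 0) (U ∩ (e ∩ L'ᶜ)) - prob (Function.update (Function.update (Function.update (Function.update (Function.update (Function.update p 0 0) 1 0) 2 0) 3 0) 4 0) 4 0) U * prob (Function.update (Function.update (Function.update (Function.update (Function.update (Function.update p 0 0) 1 0) 2 0) 3 0) 4 0) 4 0) (e ∩ L'ᶜ)) := by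
    intro 𝓔' h𝓔'
    have := zc_k4_embed (ends := ends) (p := (Function.update (Function.update (Function.update (Function.update (Function.update (Function.update p 0 0) 1 0) 2 0) 3 0) 4 0) 4 0)) (((((((hp).update 0 le_rfl zero_le_one).update 1 le_rfl zero_le_one).update 2 le_rfl zero_le_one).update 3 le_rfl zero_le_one).update 4 le_rfl zero_le_one).update 4 le_rfl zero_le_one) (ι := ![5, 6, 3, 4]) (by decide)
      (φ := ![10, 6, 8, 7, 9, 5]) (by decide) (by decide) ?_ h𝓔'
    · simpa using this
    intro e he
    fin_cases e
    · simp [Function.update]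
    · simp [Function.update]
    · simp [Function.update]
    · simp [Function.update]
    · simp [Function.update]
    · exact absurd he (by decide)
    · exact absurd he (by decide)
    · exact absurd he (by decide)
    · exact absurd he (by decide)
    · exact absurd he (by decide)
    · exact absurd he (by decide)
  have h := zc_of_dismantling₆ (ends := ends)
    [((1 : Fin 7), (0 : Fin 11), (1 : Fin 11), (0 : Fin 7), (2 : Fin 7), (0 : Fin 7), (1 : Fin 7), (3 : Fin 7)),
     (0, 2, 3, 1, 6, 2, 1, 3),
     (4, 4, 4, 2, 5, 2, 6, 3)]
    (by decide) (by decide) (by decide) p hp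
    (by intro r hr e he; simp only [List.mem_cons, List.not_mem_nil, or_false] at hr;
        rcases hr with rfl | rfl | rfl <;> (fin_cases e <;> simp [ends] at he ⊢))
    (0, 1, 3) 𝓔 h𝓔 (by intro r hr; simp at hr; rw [← hr])
    (by intro 𝓔' h𝓔'; simpa using hb 𝓔' h𝓔')
  simpa using h

/-- **`K₄` plus a pendant mark**: the same graph with `o = 4` the leaf — the mark moves to its neighbour `3` and the base is the `K₄` with the marks `(0, 1, 3)` (a relabelled `zc_k4`). -/
theorem zc_k4_pendant_mark {R : Type*} [CommRing R] [LinearOrder R] [IsStrictOrderedRing R]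
    {p : Fin 7 → R} (hp : IsProbVec p) {𝓔 : Set (Set (Fin 5))} (h𝓔 : IsUpperSet 𝓔) :
    let ends : Fin 7 → Sym2 (Fin 5) := ![s(0, 1), s(0, 2), s(0, 3), s(1, 2), s(1, 3), s(2, 3), s(3, 4)]
    let e := connEvent ends 0 1
    let L' := connEvent ends 0 4
    let U := clusterInEvent ends 0 𝓔
    let γ := connEvent ends 1 4
    0 ≤ prob p (eᶜ ∩ L'ᶜ ∩ γᶜ) * (prob p (U ∩ (e ∩ L')) - prob p U * prob p (e ∩ L'))
      - prob p (eᶜ ∩ L'ᶜ ∩ γ) * (prob p (U ∩ (e ∩ L'ᶜ)) - prob p U * prob p (e ∩ L'ᶜ)) := by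
  intro ends e L' U γ
  have hb : ∀ 𝓔' : Set (Set (Fin 5)), IsUpperSet 𝓔' →
      let e := connEvent ends 0 1
      let L' := connEvent ends 0 3
      let U := clusterInEvent ends 0 𝓔'
      let γ := connEvent ends 1 3
      0 ≤ prob (Function.update (Function.update p 6 0) 6 0) (eᶜ ∩ L'ᶜ ∩ γᶜ) * (prob (Function.update (Function.update p 6 0) 6 0) (U ∩ (e ∩ L')) - prob (Function.update (Function.update p 6 0) 6 0) U * prob (Function.update (Function.update p 6 0) 6 0) (e ∩ L'))
        - prob (Function.update (Function.update p 6 0) 6 0) (eᶜ ∩ L'ᶜ ∩ γ) * (prob (Function.update (Function.update p 6 0) 6 0) (U ∩ (e ∩ L'ᶜ)) - prob (Function.update (Function.update p 6 0) 6 0) U * prob (Function.update (Function.update p 6 0) 6 0) (e ∩ L'ᶜ)) := by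
    intro 𝓔' h𝓔'
    have := zc_k4_embed (ends := ends) (p := (Function.update (Function.update p 6 0) 6 0)) (((hp).update 6 le_rfl zero_le_one).update 6 le_rfl zero_le_one) (ι := ![0, 1, 3, 2]) (by decide)
      (φ := ![0, 2, 1, 4, 3, 5]) (by decide) (by decide) ?_ h𝓔'
    · simpa using this
    intro e he
    fin_cases e
    · exact absurd he (by decide)
    · exact absurd he (by decide)
    · exact absurd he (by decide)
    · exact absurd he (by decide)
    · exact absurd he (by decide)
    · exact absurd he (by decide)
    · simp [Function.update]
  have h := zc_of_dismantling₆ (ends := ends)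
    [((4 : Fin 7), (6 : Fin 7), (6 : Fin 7), (4 : Fin 5), (3 : Fin 5), (0 : Fin 5), (1 : Fin 5), (4 : Fin 5))]
    (by decide) (by decide) (by decide) p hp
    (by intro r hr e he; simp only [List.mem_singleton] at hr; subst hr; fin_cases e <;> simp [ends] at he ⊢)
    (0, 1, 4) 𝓔 h𝓔 (by intro r hr; simp at hr; rw [← hr])
    (by intro 𝓔' h𝓔'; simpa using hb 𝓔' h𝓔')
  simpa using h

end Summit.Ventures.PercRepro2
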